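import Summits.HodgeConjecture.HodgeConjecture.Theorems.SignSymmetricPowersGeneralPencil
import Literature.AlgebraicGeometry.HodgeTheory.MonodromyMumfordTateHeredityCurves
import Literature.AlgebraicGeometry.HodgeTheory.MonomialSupportedHypersurfaceFamilyPoints
import Literature.AlgebraicGeometry.Motives.MonomialSupportedFamilyQuasiProjective
import Mathlib.Analysis.Normed.Module.Connected
import Mathlib.LinearAlgebra.Complex.FiniteDimensional
import HarnessLib

/-!
# Route `SignSymmetricPowers` — HEREDITY ON PENCILS of ι-even threefolds: every pencil `F₀ + u·G` through an ι-even threefold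
# `F₀ = 0` with a finite-index monodromy subgroup in its Mumford–Tate group has the Hodge conjecture on all self-powers at ALL BUT
# COUNTABLY MANY members, for EVERY ι-even direction `G` (unconditional; CDK-free)

Support file for crux K1-B (stmt-HodgeConjecture-19716; `--supports … --as helper`; nothing here closes an item). Prover seat
`hodge-nonav-prover-Ax` (g16), programme «HEREDITY-B»: the route-B twin of `CyclicUnitaryPowersHeredityPencils`, consuming the GENERIC
curve heredity `exists_countable_finiteIndex_le_mumfordTateGroup_of_curve` (Literature `MonodromyMumfordTateHeredityCurves`, itself
unconditional through the cell's theorem `griffiths1968_holomorphicHodgeSubbundlesQP_holds`) for the `M_ι`-supported family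
`familyM ℂ 3 d M_ι`, `M_ι = {m | m₀ + m₁ even}`, and the route-B per-point kernel `signModel_of_identityComponent_le_mumfordTate` (g15 ∕ 20241-p1).

* `pathConnectedSpace_pencilBase_signEven` — the complex points of the pencil base of `(F₀, G)` (the cofinite set of `u` with
  `F₀ + u·G` nonsingular, `MonomialPencil.range_pencilCoord`) are path connected.
* **`hodgeConjectureFor_signPowers_offCountable_of_pencil_of_finiteIndex`** — `d` even `≥ 4`; `F₀, G` ι-even quinary forms of degree
  `d`, `F₀ = 0` nonsingular; HYPOTHESIS `hFI`: some finite-index subgroup of the monodromy group of `familyM ℂ 3 d M_ι` at the point of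
  `F₀` lies in `MT(H³)` (stated on the model-free Hodge structure `BettiUniverse.hodge`). Then there is a countable `C ⊆ ℂ` such that for
  `u ∉ C` every smooth projective threefold `X ⊂ ℙ⁴` cut out by `F₀ + u·G` and every self fibre power `Y = X^{k+1}` satisfy
  `HodgeConjectureFor (3(k+1)) Y` — for EVERY ι-even direction `G` (compare `exists_goodPencil_through_holds`: SOME direction through
  every smooth `F₀`).

HONEST FRAMING: unconditional (axioms standard, no named fact), structural: `hFI` is a transcendental hypothesis on `F₀` (e.g. Hodge
genericity of its point, by Deligne's lemma) and the countable set is unspecified; items 19716 ∕ 19715 stay OPEN at their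
Cattani–Deligne–Kaplan floor (reading (b)); rung F-H1 not moved; nothing here says HC ∕ HC_CM ∕ HC_AV is proved.

## References
* [CarlsonMullerStachPeters2017] J. Carlson, S. Müller-Stach, C. Peters, Period Mappings and Period Domains, 2nd ed., §15.3.
* [Griffiths1968PeriodsII] P. Griffiths, Periods of integrals on algebraic manifolds II, Amer. J. Math. 90 (1968), Thm. 1.1.
* [Deligne1972WeilK3] P. Deligne, La conjecture de Weil pour les surfaces K3, Invent. Math. 15 (1972), Prop. 7.5.
* [VoisinHodgeII2003] C. Voisin, *Hodge Theory and Complex Algebraic Geometry II*, §3.1.2, §6.2.1.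
-/

noncomputable section

set_option linter.dupNamespace false

namespace Summit.HodgeConjecture.HodgeConjecture.Theorems.SignSymmetricPowersGeneralPencil

open scoped TensorProduct Topology
open CategoryTheory CategoryTheory.Limits AlgebraicGeometry Set
open _root_.Topology _root_.Filter
open Literature.AlgebraicGeometry.Motives Literature.AlgebraicGeometry.HodgeTheory
open Literature.AlgebraicGeometry.HodgeTheory.BettiUniverse
open Literature.AlgebraicGeometry.Motives.UniversalHypersurface Literature.AlgebraicGeometry.HodgeTheory.UniversalHypersurface
open Literature.AlgebraicGeometry.HodgeTheory.MonomialPencil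
open Literature.AlgebraicGeometry.FundamentalGroup
open Literature.AlgebraicTopology.SingularHomology
open Literature.AlgebraicGeometry.Motives.SmoothHypersurface (IsNonsingularForm)
open Summit.HodgeConjecture.HodgeConjecture.Theorems.SignSymmetricPowersConfluenceLinkG (isSupportedOn_of_coeff_odd_eq_zero)
open Summit.HodgeConjecture.HodgeConjecture.Theorems.SignSymmetricPowersFourFactsGeometricGenus (signDeckHodge_of_genusBound)
open Summit.HodgeConjecture.HodgeConjecture.Theorems.SmoothHypersurfaceGeometricGenus (stub_genusBoundThreefold)

/-! ### §1 The pencil base of a pencil of ι-even forms is path connected -/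

/-- The nonsingular parameters of a pencil `F₀ + u·G` of quinary forms of degree `d ≥ 2` with `F₀` nonsingular form a cofinite, hence
path-connected, subset of `ℂ` (the roots of the non-zero restriction of a discriminant equation). [cite: VoisinHodgeII2003, §6.2.1] -/
theorem isPathConnected_setOf_isNonsingularForm_add_C_mul {d : ℕ} (hd : 2 ≤ d) {F₀ G : MvPolynomial (Fin 5) ℂ}
    (hF₀ : F₀.IsHomogeneous d) (hG : G.IsHomogeneous d) (hJ : IsNonsingularForm ℂ F₀) :
    IsPathConnected {u : ℂ | IsNonsingularForm ℂ (F₀ + MvPolynomial.C u * G)} := by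
  classical
  obtain ⟨Disc, -, hDisc⟩ := exists_irreducible_discriminantForm (n := 3) (d := d) hd
  have hform : ∀ u : ℂ, formOfCoeffs (coeffsOf 3 d F₀ + u • coeffsOf 3 d G) = F₀ + MvPolynomial.C u * G := fun u => by
    rw [formOfCoeffs_add, formOfCoeffs_smul, formOfCoeffs_coeffsOf 3 d hF₀, formOfCoeffs_coeffsOf 3 d hG,
      MvPolynomial.smul_eq_C_mul]
  have hF₀U : coeffsOf 3 d F₀ ∈ affineHypersurfaceComplement ![Disc] := by
    rw [mem_affineHypersurfaceComplement_iff]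
    intro j
    fin_cases j
    intro h0
    have hmem : coeffsOf 3 d F₀ ∈ singularCoeffs 3 d := (hDisc _).2 h0
    rw [mem_singularCoeffs_iff, formOfCoeffs_coeffsOf 3 d hF₀] at hmem
    exact hmem hJ
  have hsub : {u : ℂ | IsNonsingularForm ℂ (F₀ + MvPolynomial.C u * G)}ᶜ ⊆ lineRoots ![Disc] (coeffsOf 3 d F₀) (coeffsOf 3 d G) := by
    intro u hu
    rw [mem_compl_iff, mem_setOf_eq] at hu
    refine ⟨0, ?_⟩
    change MvPolynomial.eval (coeffsOf 3 d F₀ + u • coeffsOf 3 d G) Disc = 0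
    rw [← hDisc, mem_singularCoeffs_iff, hform]
    exact hu
  have hcount : ({u : ℂ | IsNonsingularForm ℂ (F₀ + MvPolynomial.C u * G)}ᶜ).Countable :=
    ((lineRoots_finite hF₀U (coeffsOf 3 d G)).subset hsub).countable
  have h := hcount.isPathConnected_compl_of_one_lt_rank (E := ℂ) (by rw [Complex.rank_real_complex]; norm_num)
  rwa [compl_compl] at h

/-- **The complex points of the pencil base of a pencil of `M`-supported forms are path connected** (`(coeff_m G)_{m ∈ M} ≠ 0`,
`F₀` nonsingular): `P(ℂ)` embeds in `ℂ` by the coordinate (`isEmbedding_pencilCoord`) with cofinite image (`range_pencilCoord`).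
[cite: VoisinHodgeII2003, §6.2.1] -/
theorem pathConnectedSpace_pencilBase_signEven {d : ℕ} (hd : 2 ≤ d) (M : Set (DegIndex 3 d)) {F₀ G : MvPolynomial (Fin 5) ℂ}
    (hF₀ : F₀.IsHomogeneous d) (hG : G.IsHomogeneous d) (hMF : IsSupportedOn 3 d M F₀) (hMG : IsSupportedOn 3 d M G)
    (hJ : IsNonsingularForm ℂ F₀) (hg : coeffsM 3 d M G ≠ 0) :
    PathConnectedSpace (ComplexPoints (pencilBase 3 d M (coeffsM 3 d M F₀) (coeffsM 3 d M G))) := by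
  have hemb := isEmbedding_pencilCoord 3 d M (coeffsM 3 d M F₀) hg
  haveI : PathConnectedSpace (Set.range (pencilCoord 3 d M (coeffsM 3 d M F₀) (coeffsM 3 d M G))) := by
    rw [← isPathConnected_iff_pathConnectedSpace, range_pencilCoord 3 d M hF₀ hG hMF hMG]
    exact isPathConnected_setOf_isNonsingularForm_add_C_mul hd hF₀ hG hJ
  exact hemb.toHomeomorph.symm.surjective.pathConnectedSpace hemb.toHomeomorph.symm.continuous

/-! ### §2 Heredity on pencils of ι-even threefolds -/

/-- **HEREDITY ON PENCILS OF ι-EVEN THREEFOLDS** (unconditional). `d` even `≥ 4`; `F₀, G` ι-even quinary forms of degree `d` with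
`F₀ = 0` nonsingular; hypothesis `hFI`: for the `M_ι`-supported family `π = familyM ℂ 3 d M_ι` (any proofs `hu`, `hU` of its smoothness and
local triviality) some finite-index subgroup of the monodromy group of `π` at the point of `F₀` lies in the Mumford–Tate group of the
(model-free) Hodge structure on `H³`. Then there is a COUNTABLE `C ⊆ ℂ` such that for every `u ∉ C`, every smooth projective threefold
`X ⊂ ℙ⁴` cut out by `F₀ + u·G` and every self fibre power `Y = X^{k+1}` satisfy `HodgeConjectureFor (3(k+1)) Y`. No hypothesis on `G`
beyond ι-evenness; NOT items 19716 ∕ 19715 (CDK floor). [cite: CarlsonMullerStachPeters2017, §15.3 (15.7) and Lemma–Definition 15.3.7]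
[cite: Griffiths1968PeriodsII, Thm. 1.1] [cite: Deligne1972WeilK3, Prop. 7.5] [cite: VoisinHodgeII2003, §3.1.2 and §6.2.1] -/
theorem hodgeConjectureFor_signPowers_offCountable_of_pencil_of_finiteIndex
    {d : ℕ} (hd : Even d) (h4 : 4 ≤ d) {F₀ G : MvPolynomial (Fin 5) ℂ} (hF₀ : F₀.IsHomogeneous d) (hG : G.IsHomogeneous d)
    (hevF : ∀ e : Fin 5 →₀ ℕ, ¬ Even (e 0 + e 1) → F₀.coeff e = 0) (hevG : ∀ e : Fin 5 →₀ ℕ, ¬ Even (e 0 + e 1) → G.coeff e = 0)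
    (hJ : IsNonsingularForm ℂ F₀)
    (hFI : ∀ (hu : IsSmoothProjectiveFamily (familyM ℂ 3 d {m : DegIndex 3 d | Even (m.1 0 + m.1 1)}) 3)
        (hU : IsCohomologicallyLocallyTrivialOn (familyM ℂ 3 d {m : DegIndex 3 d | Even (m.1 0 + m.1 1)})
          (univ : Set (ComplexPoints (baseM ℂ 3 d {m : DegIndex 3 d | Even (m.1 0 + m.1 1)})))),
      haveI : HodgeTensorFacts.{0, 0} := hodgeTensorFacts_holds
      haveI : ∀ t, Module.Finite ℚ (bettiCohomology (fiberOver (familyM ℂ 3 d {m : DegIndex 3 d | Even (m.1 0 + m.1 1)}) t) 3) :=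
        fun t => finite (hu.isSmoothProjective t) 3
      letI t₀ := pointOfFormM ℂ 3 d {m : DegIndex 3 d | Even (m.1 0 + m.1 1)} hF₀ hJ (isSupportedOn_of_coeff_odd_eq_zero hevF)
      ∃ Γ₀ : Subgroup (bettiCohomology (fiberOver (familyM ℂ 3 d {m : DegIndex 3 d | Even (m.1 0 + m.1 1)}) t₀) 3 ≃ₗ[ℚ]
          bettiCohomology (fiberOver (familyM ℂ 3 d {m : DegIndex 3 d | Even (m.1 0 + m.1 1)}) t₀) 3),
        Γ₀ ≤ ratMonodromyGroup (familyM ℂ 3 d {m : DegIndex 3 d | Even (m.1 0 + m.1 1)}) 3 hU ⟨t₀, mem_univ _⟩ ∧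
        (Γ₀.subgroupOf (ratMonodromyGroup (familyM ℂ 3 d {m : DegIndex 3 d | Even (m.1 0 + m.1 1)}) 3 hU ⟨t₀, mem_univ _⟩)).FiniteIndex ∧
        Γ₀ ≤ (hodge exists_isReal_hodgeModel_holds (hu.isSmoothProjective t₀) 3).mumfordTateGroup) :
    ∃ C : Set ℂ, C.Countable ∧ ∀ u : ℂ, u ∉ C →
      ∀ ⦃X : SchemeOver ℂ⦄, IsSmoothProjective 3 X → IsHypersurfaceCutOutBy 4 (F₀ + MvPolynomial.C u * G) X →
        ∀ ⦃k : ℕ⦄ ⦃Y : SchemeOver ℂ⦄, (∃ π : Fin (k + 1) → (Y ⟶ X), Nonempty (IsLimit (Fan.mk Y π))) →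
          HodgeConjectureFor (3 * (k + 1)) Y := by
  classical
  haveI hHTF : HodgeTensorFacts.{0, 0} := hodgeTensorFacts_holds
  have hd2 : 2 ≤ d := by omega
  -- ### (K) the pointwise kernel on the named family
  have hK := SignSymmetricPowersPencilKernel.signModel_of_identityComponent_le_mumfordTate
    (signDeckHodge_of_genusBound stub_genusBoundThreefold) affineHypersurfaceComplement_meridians_normalClosure_eq_top_holds
    discriminant_localBranches_nodal_holds WeightedPencil.symmetricA3NonCommutation_mono_holds affineHypersurfaceComplement_meridian_isConj_holds
  obtain ⟨hu, hU, A, hA, hfin, t₀, hK⟩ := hK hd h4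
  have hMF : IsSupportedOn 3 d {m : DegIndex 3 d | Even (m.1 0 + m.1 1)} F₀ := isSupportedOn_of_coeff_odd_eq_zero hevF
  have hMG : IsSupportedOn 3 d {m : DegIndex 3 d | Even (m.1 0 + m.1 1)} G := isSupportedOn_of_coeff_odd_eq_zero hevG
  haveI : ∀ t : ComplexPoints (baseM ℂ 3 d {m : DegIndex 3 d | Even (m.1 0 + m.1 1)}),
      Module.Finite ℚ (bettiCohomology (fiberOver (familyM ℂ 3 d {m : DegIndex 3 d | Even (m.1 0 + m.1 1)}) t) 3) := hfin
  -- the quasi-projective / smooth base and total space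
  have hSM : IsQuasiProjectiveOver (baseM ℂ 3 d {m : DegIndex 3 d | Even (m.1 0 + m.1 1)}) := isQuasiProjectiveOver_baseM 3 d _
  have hSs : Smooth (baseM ℂ 3 d {m : DegIndex 3 d | Even (m.1 0 + m.1 1)}).hom := smooth_baseM_hom ℂ 3 d _
  have h𝒳M : IsQuasiProjectiveOver (totalM ℂ 3 d {m : DegIndex 3 d | Even (m.1 0 + m.1 1)}) := isQuasiProjectiveOver_totalM ℂ 3 d _ (by omega)
  -- ### FI at the point of `F₀`, in the models `A` of the kernel
  have hFI₀ := hFI hu hU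
  have hHS : ∀ t : ComplexPoints (baseM ℂ 3 d {m : DegIndex 3 d | Even (m.1 0 + m.1 1)}),
      (A t).hodgeStructure (hu.isSmoothProjective t) (hA t) 3 = hodge exists_isReal_hodgeModel_holds (hu.isSmoothProjective t) 3 :=
    fun t => HodgeModel.hodgeStructure_eq_hodge exists_isReal_hodgeModel_holds hodgePQ_independent_of_hodgeModel_holds _ _ _ 3
  -- ### the member `F₀ + u G` is homogeneous, ι-even
  have hfu : ∀ u : ℂ, (F₀ + MvPolynomial.C u * G).IsHomogeneous d := fun u => isHomogeneous_add_C_mul 3 d hF₀ hG u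
  have hevu : ∀ (u : ℂ) (e : Fin 5 →₀ ℕ), ¬ Even (e 0 + e 1) → (F₀ + MvPolynomial.C u * G).coeff e = 0 := fun u e he => by
    rw [MvPolynomial.coeff_add, MvPolynomial.coeff_C_mul, hevF e he, hevG e he, mul_zero, add_zero]
  -- ### the conclusion at a member, from `(Γ^Zar)⁰ ⊆ MT` at its classifying point
  have conclude : ∀ u : ℂ, IsNonsingularForm ℂ (F₀ + MvPolynomial.C u * G) →
      (glIdentityComponent (ratMonodromyGroup (familyM ℂ 3 d {m : DegIndex 3 d | Even (m.1 0 + m.1 1)}) 3 hU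
          ⟨classifyingPoint ℂ 3 d {m : DegIndex 3 d | Even (m.1 0 + m.1 1)} t₀ (F₀ + MvPolynomial.C u * G), mem_univ _⟩) ⊆
        (((A (classifyingPoint ℂ 3 d {m : DegIndex 3 d | Even (m.1 0 + m.1 1)} t₀ (F₀ + MvPolynomial.C u * G))).hodgeStructure
            (hu.isSmoothProjective (classifyingPoint ℂ 3 d {m : DegIndex 3 d | Even (m.1 0 + m.1 1)} t₀ (F₀ + MvPolynomial.C u * G)))
            (hA (classifyingPoint ℂ 3 d {m : DegIndex 3 d | Even (m.1 0 + m.1 1)} t₀ (F₀ + MvPolynomial.C u * G))) 3).mumfordTateGroup :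
          Set (bettiCohomology (fiberOver (familyM ℂ 3 d {m : DegIndex 3 d | Even (m.1 0 + m.1 1)})
              (classifyingPoint ℂ 3 d {m : DegIndex 3 d | Even (m.1 0 + m.1 1)} t₀ (F₀ + MvPolynomial.C u * G))) 3 ≃ₗ[ℚ]
            bettiCohomology (fiberOver (familyM ℂ 3 d {m : DegIndex 3 d | Even (m.1 0 + m.1 1)})
              (classifyingPoint ℂ 3 d {m : DegIndex 3 d | Even (m.1 0 + m.1 1)} t₀ (F₀ + MvPolynomial.C u * G))) 3))) →
      ∀ ⦃X : SchemeOver ℂ⦄, IsSmoothProjective 3 X → IsHypersurfaceCutOutBy 4 (F₀ + MvPolynomial.C u * G) X →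
        ∀ ⦃k : ℕ⦄ ⦃Y : SchemeOver ℂ⦄, (∃ π : Fin (k + 1) → (Y ⟶ X), Nonempty (IsLimit (Fan.mk Y π))) →
          HodgeConjectureFor (3 * (k + 1)) Y := by
    intro u hJu hΓ X hX hcut k Y hY
    obtain ⟨eX⟩ := hcut.nonempty_iso_hypersurface
    have hXF : IsSmoothProjective 3 (SmoothHypersurface.hypersurface (F₀ + MvPolynomial.C u * G)) := hX.of_iso eX
    have ha := signUnits_two_mem_diagonalStabilizer (F₀ + MvPolynomial.C u * G) (hevu u)
    obtain ⟨⟨h1, h2, h3⟩, hComm⟩ := hK (F₀ + MvPolynomial.C u * G) (hfu u) (hevu u) hJu hXF ha hΓ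
    exact SignSymmetricPowersClose.powersHodgeOfSignCommutators hd h4 hX ⟨F₀ + MvPolynomial.C u * G, hfu u, hevu u, hcut⟩
      ⟨eX.hom ≫ diagonalAut _ ha ≫ eX.inv, ⟨pull_conj_sq_eq_one_of_iso eX h1, tr_cup_pull_conj_of_iso hX hXF eX h2,
        fun j q hj hq => by
          rw [finrank_eigenspace_inf_piece_eq_of_iso exists_isReal_hodgeModel_holds hodgePQ_independent_of_hodgeModel_holds hX hXF
            eX (diagonalAut _ ha) 3]
          exact h3 j q hj hq⟩,
        comm_of_iso exists_isReal_hodgeModel_holds hodgePQ_independent_of_hodgeModel_holds hX hXF eX (diagonalAut _ ha) 3 hComm⟩ hY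
  -- transport of «`(Γ^Zar)⁰ ⊆ MT`» along an equality of points
  have keyΓ : ∀ (t t' : ComplexPoints (baseM ℂ 3 d {m : DegIndex 3 d | Even (m.1 0 + m.1 1)})), t = t' →
      (glIdentityComponent (ratMonodromyGroup (familyM ℂ 3 d {m : DegIndex 3 d | Even (m.1 0 + m.1 1)}) 3 hU ⟨t, mem_univ _⟩) ⊆
        (((A t).hodgeStructure (hu.isSmoothProjective t) (hA t) 3).mumfordTateGroup :
          Set (bettiCohomology (fiberOver (familyM ℂ 3 d {m : DegIndex 3 d | Even (m.1 0 + m.1 1)}) t) 3 ≃ₗ[ℚ]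
            bettiCohomology (fiberOver (familyM ℂ 3 d {m : DegIndex 3 d | Even (m.1 0 + m.1 1)}) t) 3))) →
      glIdentityComponent (ratMonodromyGroup (familyM ℂ 3 d {m : DegIndex 3 d | Even (m.1 0 + m.1 1)}) 3 hU ⟨t', mem_univ _⟩) ⊆
        (((A t').hodgeStructure (hu.isSmoothProjective t') (hA t') 3).mumfordTateGroup :
          Set (bettiCohomology (fiberOver (familyM ℂ 3 d {m : DegIndex 3 d | Even (m.1 0 + m.1 1)}) t') 3 ≃ₗ[ℚ]
            bettiCohomology (fiberOver (familyM ℂ 3 d {m : DegIndex 3 d | Even (m.1 0 + m.1 1)}) t') 3)) := by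
    rintro t t' rfl h; exact h
  by_cases hg : coeffsM 3 d {m : DegIndex 3 d | Even (m.1 0 + m.1 1)} G = 0
  · -- ### degenerate direction: `G` is supported on `M_ι` with all `M_ι`-coefficients zero, so `G = 0` and every member is `F₀`
    have hG0 : G = 0 := by
      have h0 := eq_add_C_mul_of_coeff 3 d {m : DegIndex 3 d | Even (m.1 0 + m.1 1)} hG hG hMG hMG
        (F := 0) (MvPolynomial.isHomogeneous_zero _ _ d) (isSupportedOn_of_coeff_odd_eq_zero fun e _ => MvPolynomial.coeff_zero e)
        (u := 0) fun m => by
          have hm : coeffsM 3 d {m : DegIndex 3 d | Even (m.1 0 + m.1 1)} G m = 0 := by rw [hg]; rfl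
          change MvPolynomial.coeff m.1.1 (0 : MvPolynomial (Fin 5) ℂ) = _
          rw [MvPolynomial.coeff_zero, zero_mul, add_zero]
          exact hm.symm
      rw [map_zero, zero_mul, add_zero] at h0
      exact h0.symm
    subst hG0
    refine ⟨∅, countable_empty, fun u _ X hX hcut k Y hY => ?_⟩
    have hJu : IsNonsingularForm ℂ (F₀ + MvPolynomial.C u * 0) := by rw [mul_zero, add_zero]; exact hJ
    have hpt : pointOfFormM ℂ 3 d {m : DegIndex 3 d | Even (m.1 0 + m.1 1)} hF₀ hJ hMF =
        classifyingPoint ℂ 3 d {m : DegIndex 3 d | Even (m.1 0 + m.1 1)} t₀ (F₀ + MvPolynomial.C u * 0) := by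
      have hF : F₀ + MvPolynomial.C u * (0 : MvPolynomial (Fin 5) ℂ) = F₀ := by rw [mul_zero, add_zero]
      rw [hF, classifyingPoint_eq ℂ 3 d _ t₀ hF₀ hJ hMF]
    have hΓ₀ : glIdentityComponent (ratMonodromyGroup (familyM ℂ 3 d {m : DegIndex 3 d | Even (m.1 0 + m.1 1)}) 3 hU
          ⟨pointOfFormM ℂ 3 d {m : DegIndex 3 d | Even (m.1 0 + m.1 1)} hF₀ hJ hMF, mem_univ _⟩) ⊆
        (((A _).hodgeStructure (hu.isSmoothProjective (pointOfFormM ℂ 3 d {m : DegIndex 3 d | Even (m.1 0 + m.1 1)} hF₀ hJ hMF))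
            (hA _) 3).mumfordTateGroup :
          Set (bettiCohomology (fiberOver (familyM ℂ 3 d {m : DegIndex 3 d | Even (m.1 0 + m.1 1)})
              (pointOfFormM ℂ 3 d {m : DegIndex 3 d | Even (m.1 0 + m.1 1)} hF₀ hJ hMF)) 3 ≃ₗ[ℚ]
            bettiCohomology (fiberOver (familyM ℂ 3 d {m : DegIndex 3 d | Even (m.1 0 + m.1 1)})
              (pointOfFormM ℂ 3 d {m : DegIndex 3 d | Even (m.1 0 + m.1 1)} hF₀ hJ hMF)) 3)) := by
      obtain ⟨Γ₀, hle, hfi, hMT⟩ := hFI₀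
      rw [← hHS] at hMT
      exact (glIdentityComponent_subset_of_finiteIndex hle hfi).trans (glZariskiClosure_subset_mumfordTateGroup _ hMT)
    exact conclude u hJu (keyΓ _ _ hpt hΓ₀) hX hcut hY
  · -- ### the pencil `ι : P ⟶ S_{M_ι}`
    let ι := pencilMap 3 d {m : DegIndex 3 d | Even (m.1 0 + m.1 1)} (coeffsM 3 d _ F₀) (coeffsM 3 d _ G)
    have hPq : IsQuasiProjectiveOver (pencilBase 3 d {m : DegIndex 3 d | Even (m.1 0 + m.1 1)} (coeffsM 3 d _ F₀) (coeffsM 3 d _ G)) :=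
      isQuasiProjectiveOver_baseSpz 3 d _
    haveI : SmoothOfRelativeDimension 1 (pencilBase 3 d {m : DegIndex 3 d | Even (m.1 0 + m.1 1)} (coeffsM 3 d _ F₀) (coeffsM 3 d _ G)).hom := by
      have h1 := smoothOfRelativeDimension_baseSpz_hom ℂ 3 d (pencilCompSpz 3 d {m : DegIndex 3 d | Even (m.1 0 + m.1 1)} (coeffsM 3 d _ F₀) (coeffsM 3 d _ G))
      rwa [Nat.card_eq_fintype_card, Fintype.card_fin, zero_add] at h1
    haveI := pathConnectedSpace_pencilBase_signEven hd2 {m : DegIndex 3 d | Even (m.1 0 + m.1 1)} hF₀ hG hMF hMG hJ hg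
    -- the point `u = 0`
    have hJ0 : IsNonsingularForm ℂ (F₀ + MvPolynomial.C (0 : ℂ) * G) := by simpa using hJ
    obtain ⟨c₀, hc₀, -⟩ := exists_pencilCoord_eq 3 d _ hF₀ hG hMF hMG hJ0
    have ht₀ : AlgPoints.map ι c₀ = pointOfFormM ℂ 3 d {m : DegIndex 3 d | Even (m.1 0 + m.1 1)} hF₀ hJ hMF := by
      have h1 := classifyingPoint_eq_map_pencilMap 3 d {m : DegIndex 3 d | Even (m.1 0 + m.1 1)} hF₀ hG hMF hMG t₀ c₀
      rw [hc₀] at h1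
      rw [← h1]
      have hF : F₀ + MvPolynomial.C (0 : ℂ) * G = F₀ := by simp
      rw [hF, classifyingPoint_eq ℂ 3 d _ t₀ hF₀ hJ hMF]
    -- FI at `ι c₀` in the models `A`
    have hFI' : ∃ Γ₀ : Subgroup (bettiCohomology (fiberOver (familyM ℂ 3 d {m : DegIndex 3 d | Even (m.1 0 + m.1 1)})
          (pointOfFormM ℂ 3 d {m : DegIndex 3 d | Even (m.1 0 + m.1 1)} hF₀ hJ hMF)) 3 ≃ₗ[ℚ]
          bettiCohomology (fiberOver (familyM ℂ 3 d {m : DegIndex 3 d | Even (m.1 0 + m.1 1)})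
            (pointOfFormM ℂ 3 d {m : DegIndex 3 d | Even (m.1 0 + m.1 1)} hF₀ hJ hMF)) 3),
        Γ₀ ≤ ratMonodromyGroup (familyM ℂ 3 d {m : DegIndex 3 d | Even (m.1 0 + m.1 1)}) 3
          (isCohomologicallyLocallyTrivialOn_univ_of_isQuasiProjectiveOver (familyM ℂ 3 d {m : DegIndex 3 d | Even (m.1 0 + m.1 1)}) hu hSM hSs)
          ⟨_, mem_univ _⟩ ∧
        (Γ₀.subgroupOf (ratMonodromyGroup (familyM ℂ 3 d {m : DegIndex 3 d | Even (m.1 0 + m.1 1)}) 3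
          (isCohomologicallyLocallyTrivialOn_univ_of_isQuasiProjectiveOver (familyM ℂ 3 d {m : DegIndex 3 d | Even (m.1 0 + m.1 1)}) hu hSM hSs)
          ⟨_, mem_univ _⟩)).FiniteIndex ∧
        Γ₀ ≤ ((A (pointOfFormM ℂ 3 d {m : DegIndex 3 d | Even (m.1 0 + m.1 1)} hF₀ hJ hMF)).hodgeStructure
          (hu.isSmoothProjective _) (hA _) 3).mumfordTateGroup := by
      obtain ⟨Γ₀, hle, hfi, hMT⟩ := hFI₀
      refine ⟨Γ₀, hle, hfi, ?_⟩
      rw [hHS]; exact hMT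
    -- ### generic HEREDITY along the curve `ι`
    obtain ⟨C, hCc, hC⟩ := glIdentityComponent_subset_mumfordTateGroup_offCountable_of_curve
      (familyM ℂ 3 d {m : DegIndex 3 d | Even (m.1 0 + m.1 1)}) 3 3 hu hSM hSs A hA ι h𝒳M hPq c₀ _ ht₀ hFI'
    -- ### the countable exceptional set of parameters: coordinates of `C` and the singular parameters
    refine ⟨pencilCoord 3 d _ (coeffsM 3 d _ F₀) (coeffsM 3 d _ G) '' C ∪ {u | ¬ IsNonsingularForm ℂ (F₀ + MvPolynomial.C u * G)},
      (hCc.image _).union ?_, fun u hu' X hX hcut k Y hY => ?_⟩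
    · -- the singular parameters are finitely many (roots of the restricted discriminant)
      obtain ⟨Disc, -, hDisc⟩ := exists_irreducible_discriminantForm (n := 3) (d := d) hd2
      have hform : ∀ u : ℂ, formOfCoeffs (coeffsOf 3 d F₀ + u • coeffsOf 3 d G) = F₀ + MvPolynomial.C u * G := fun u => by
        rw [formOfCoeffs_add, formOfCoeffs_smul, formOfCoeffs_coeffsOf 3 d hF₀, formOfCoeffs_coeffsOf 3 d hG,
          MvPolynomial.smul_eq_C_mul]
      have hF₀U : coeffsOf 3 d F₀ ∈ affineHypersurfaceComplement ![Disc] := by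
        rw [mem_affineHypersurfaceComplement_iff]
        intro j
        fin_cases j
        intro h0
        have hmem : coeffsOf 3 d F₀ ∈ singularCoeffs 3 d := (hDisc _).2 h0
        rw [mem_singularCoeffs_iff, formOfCoeffs_coeffsOf 3 d hF₀] at hmem
        exact hmem hJ
      refine ((lineRoots_finite hF₀U (coeffsOf 3 d G)).subset fun u hu => ⟨0, ?_⟩).countable
      change MvPolynomial.eval (coeffsOf 3 d F₀ + u • coeffsOf 3 d G) Disc = 0
      rw [← hDisc, mem_singularCoeffs_iff, hform]
      exact hu
    rw [mem_union, not_or] at hu'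
    obtain ⟨hu1, hu2⟩ := hu'
    rw [mem_setOf_eq, not_not] at hu2
    obtain ⟨c, hcu, -⟩ := exists_pencilCoord_eq 3 d _ hF₀ hG hMF hMG hu2
    have hcC : c ∉ C := fun hc => hu1 ⟨c, hc, hcu⟩
    have hΓ := hC c hcC
    have hpt : AlgPoints.map ι c =
        classifyingPoint ℂ 3 d {m : DegIndex 3 d | Even (m.1 0 + m.1 1)} t₀ (F₀ + MvPolynomial.C u * G) := by
      rw [← hcu]; exact (classifyingPoint_eq_map_pencilMap 3 d _ hF₀ hG hMF hMG t₀ c).symm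
    exact conclude u hu2 (keyΓ _ _ hpt hΓ) hX hcut hY

end Summit.HodgeConjecture.HodgeConjecture.Theorems.SignSymmetricPowersGeneralPencil

end
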